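import Mathlib
import Literature.Probability.LatticeModels.SharpnessDecayProofs
import Literature.Probability.LatticeModels.HighDimTrivialityUniformProofs
import Literature.Probability.LatticeModels.GriffithsMonotonicity
import Literature.Probability.LatticeModels.OnsagerYang
import Literature.Probability.LatticeModels.PlusFreeComparison
import Literature.Probability.LatticeModels.GibbsStatesProofs
import Literature.Probability.LatticeModels.SusceptibilityMeanFieldBound
import Literature.Probability.LatticeModels.CriticalTwoPointBounds
import Literature.Probability.LatticeModels.SharpnessSubcritical
import Literature.Probability.LatticeModels.CriticalTwoPointLower
import Literature.Probability.LatticeModels.PlusStateFKG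
import Literature.Probability.LatticeModels.MessagerMiracleSole
import Literature.Probability.LatticeModels.RegularScales

/-!
# The subcritical two-point function of the `ℤ³` Ising model: inputs from the tree

Support file for item `DilutionTransfer` (stmt-CriticalPhenomena-6037) of route
`HarmonicMomentsIsotropy` (sub-problem `Ising3DConformalLimit`). It packages, for
`G_β(x) = ⟨σ₀σₓ⟩^∅_{β,0} = twoPointFree 3 β x`, the tree facts the transfer argument uses:

* `G_nonneg`, `G_le_one`, `G_zero`, `G_mono`, `G_le_critical` — Griffiths inequalities and
  monotonicity in `β` (GKS), `G_{β_c} = criticalTwoPoint`;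
* `summable_weight_mul_G` — for `0 ≤ β < β_c`, `x ↦ w(x) G_β(x)` is absolutely summable for every
  polynomially bounded weight `w` (sharpness: exponential decay below `β_c`,
  `twoPoint_exponentialDecay_of_lt_criticalBeta_holds`);
* `continuousAt_G` — `β ↦ G_β(x)` is continuous on `(0, β_c)` (left-continuity of the free state by
  GKS, right-continuity of the plus state, and `free = plus` below `β_c`);
* `continuousAt_tsum_weight_mul_G` — hence `β ↦ ∑ₓ w(x) G_β(x)` is continuous on `(0, β_c)`
  (dominated convergence through monotonicity in `β`);
* `one_le_tsum_G`, `tendsto_tsum_G_atTop` — `χ(β) ≥ 1` and `χ(β) → ∞` as `β ↑ β_c`.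

References: Friedli–Velenik, *Statistical Mechanics of Lattice Systems* (2017), Ch. 3;
Aizenman–Barsky–Fernández 1987 / Duminil-Copin–Tassion 2016 (sharpness). All inputs are proved
theorems of the tree.
-/

noncomputable section

open MeasureTheory Filter Topology Set
open scoped ENNReal NNReal BigOperators
open Literature.Probability.LatticeModels

namespace Summit.CriticalPhenomena.Ising3DConformalLimit.Theorems.HarmonicMomentsIsotropy.Ising

/-! ## Pointwise bounds and monotonicity -/

/-- `0 ≤ G_β(x)` for `β ≥ 0` (GKS I). -/
theorem G_nonneg {β : ℝ} (hβ : 0 ≤ β) (x : Site 3) : 0 ≤ twoPointFree 3 β x :=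
  twoPointFree_nonneg_of_nonneg hβ x

/-- `G_β(x) ≤ 1` for `β ≥ 0`. -/
theorem G_le_one {β : ℝ} (hβ : 0 ≤ β) (x : Site 3) : twoPointFree 3 β x ≤ 1 :=
  (twoPointFree_le_twoPointPlus_holds (d := 3) (by norm_num) hβ x).trans
    (twoPointPlus_le_one_of_nonneg hβ x)

/-- `G_β(0) = 1`. -/
theorem G_zero (β : ℝ) : twoPointFree 3 β 0 = 1 := twoPointFree_zero 3 β

/-- Monotonicity in `β` (GKS II): `G_β(x) ≤ G_{β'}(x)` for `0 ≤ β ≤ β'`. -/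
theorem G_mono {β β' : ℝ} (hβ : 0 ≤ β) (hββ' : β ≤ β') (x : Site 3) :
    twoPointFree 3 β x ≤ twoPointFree 3 β' x :=
  twoPointFree_mono_beta (isingCorr_free_mono_beta_of_gks_two fun _ _ _ _ _ _ =>
    GKSInequalities.gks_two_holds (zdGraph 3)) hasBoxLimit_isingCorr_free_holds hβ hββ' x

/-- `G_{β_c} = ⟨σ₀σₓ⟩⁺_{β_c} = criticalTwoPoint` on `ℤ³` (continuity of the phase transition). -/
theorem G_criticalBeta (x : Site 3) : twoPointFree 3 (criticalBeta 3) x = criticalTwoPoint 3 x :=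
  (twoPointPlus_criticalBeta_eq_twoPointFree_holds (d := 3) (by norm_num) x).symm

/-- `G_β ≤ G_{β_c} = criticalTwoPoint` for `0 ≤ β ≤ β_c`. -/
theorem G_le_critical {β : ℝ} (hβ : 0 ≤ β) (hβc : β ≤ criticalBeta 3) (x : Site 3) :
    twoPointFree 3 β x ≤ criticalTwoPoint 3 x := by
  rw [← G_criticalBeta]; exact G_mono hβ hβc x

/-- `β_c(3) > 0`. -/
theorem criticalBeta_three_pos : 0 < criticalBeta 3 := criticalBeta_pos_holds (by norm_num)

/-! ## Summability below `β_c` -/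

/-- Exponential decay below `β_c` (sharpness): `G_β(x) ≤ e^{-c‖x‖}`. -/
theorem exists_exp_decay {β : ℝ} (hβ : 0 ≤ β) (hβc : β < criticalBeta 3) :
    ∃ c > 0, ∀ x : Site 3, twoPointFree 3 β x ≤ Real.exp (-c * ‖x‖) :=
  twoPoint_exponentialDecay_of_lt_criticalBeta_holds (d := 3) (by norm_num) hβ hβc

/-- Polynomial versus exponential: `t^q ≤ q! (2/c)^q e^{(c/2) t}` for `t ≥ 0`, `c > 0`. -/
theorem pow_le_factorial_mul_exp {c : ℝ} (hc : 0 < c) (q : ℕ) {t : ℝ} (ht : 0 ≤ t) :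
    t ^ q ≤ (q.factorial : ℝ) * (2 / c) ^ q * Real.exp (c / 2 * t) := by
  have h := Real.pow_div_factorial_le_exp (c / 2 * t) (by positivity) q
  rw [div_le_iff₀ (by positivity), mul_pow] at h
  have hc2 : (c / 2) ^ q * (2 / c) ^ q = 1 := by
    rw [← mul_pow]; field_simp; simp
  calc t ^ q = (c / 2) ^ q * (2 / c) ^ q * t ^ q := by rw [hc2, one_mul]
    _ = (2 / c) ^ q * ((c / 2) ^ q * t ^ q) := by ring
    _ ≤ (2 / c) ^ q * (Real.exp (c / 2 * t) * q.factorial) :=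
        mul_le_mul_of_nonneg_left h (by positivity)
    _ = (q.factorial : ℝ) * (2 / c) ^ q * Real.exp (c / 2 * t) := by ring

/-- **Absolute summability of weighted two-point functions below `β_c`**: for `0 ≤ β < β_c` and a
weight with `|w(x)| ≤ A ‖x‖^q + B`, `∑ₓ |w(x)| G_β(x) < ∞`. -/
theorem summable_weight_mul_G {β : ℝ} (hβ : 0 ≤ β) (hβc : β < criticalBeta 3) {w : Site 3 → ℝ}
    {A B : ℝ} {q : ℕ} (hw : ∀ x, |w x| ≤ A * ‖x‖ ^ q + B) :
    Summable fun x : Site 3 => |w x| * twoPointFree 3 β x := by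
  obtain ⟨c, hc, hdec⟩ := exists_exp_decay hβ hβc
  have hA : 0 ≤ A * ‖(0 : Site 3)‖ ^ q + B := (abs_nonneg _).trans (hw 0)
  -- dominate by `(|A| q!(2/c)^q + |B|) e^{-(c/2)‖x‖}`
  set C : ℝ := |A| * ((q.factorial : ℝ) * (2 / c) ^ q) + |B| with hC
  refine summable_of_exp_decay (fun x => mul_nonneg (abs_nonneg _) (G_nonneg hβ x))
    (c := c / 2) (C := C) (by positivity) fun x => ?_
  have hG := hdec x
  have hG0 := G_nonneg hβ x
  have hpoly : ‖x‖ ^ q ≤ (q.factorial : ℝ) * (2 / c) ^ q * Real.exp (c / 2 * ‖x‖) :=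
    pow_le_factorial_mul_exp hc q (norm_nonneg x)
  have hexp : Real.exp (-c * ‖x‖) = Real.exp (-(c / 2) * ‖x‖) * Real.exp (-(c / 2) * ‖x‖) := by
    rw [← Real.exp_add]; ring_nf
  have hone : Real.exp (c / 2 * ‖x‖) * Real.exp (-(c / 2) * ‖x‖) = 1 := by
    rw [← Real.exp_add]; ring_nf; simp
  have hle1 : Real.exp (-(c / 2) * ‖x‖) ≤ 1 := by
    rw [Real.exp_le_one_iff]; nlinarith [norm_nonneg x]
  calc |w x| * twoPointFree 3 β x ≤ (A * ‖x‖ ^ q + B) * Real.exp (-c * ‖x‖) :=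
        mul_le_mul (hw x) hG hG0 ((abs_nonneg _).trans (hw x))
    _ ≤ (|A| * ‖x‖ ^ q + |B|) * Real.exp (-c * ‖x‖) := by
        gcongr
        · exact (le_abs_self A)
        · exact le_abs_self B
    _ ≤ (|A| * ((q.factorial : ℝ) * (2 / c) ^ q * Real.exp (c / 2 * ‖x‖)) + |B|) *
          Real.exp (-c * ‖x‖) := by gcongr
    _ = |A| * ((q.factorial : ℝ) * (2 / c) ^ q) * (Real.exp (c / 2 * ‖x‖) *
          Real.exp (-(c / 2) * ‖x‖)) * Real.exp (-(c / 2) * ‖x‖) +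
          |B| * Real.exp (-(c / 2) * ‖x‖) * Real.exp (-(c / 2) * ‖x‖) := by rw [hexp]; ring
    _ ≤ |A| * ((q.factorial : ℝ) * (2 / c) ^ q) * 1 * Real.exp (-(c / 2) * ‖x‖) +
          |B| * 1 * Real.exp (-(c / 2) * ‖x‖) := by
        rw [hone]; gcongr
    _ = C * Real.exp (-(c / 2) * ‖x‖) := by rw [hC]; ring

/-- Summability of `x ↦ w(x) G_β(x)` itself (signed weight). -/
theorem summable_weight_mul_G' {β : ℝ} (hβ : 0 ≤ β) (hβc : β < criticalBeta 3) {w : Site 3 → ℝ}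
    {A B : ℝ} {q : ℕ} (hw : ∀ x, |w x| ≤ A * ‖x‖ ^ q + B) :
    Summable fun x : Site 3 => w x * twoPointFree 3 β x := by
  refine (summable_weight_mul_G hβ hβc hw).of_norm_bounded (fun x => ?_)
  rw [Real.norm_eq_abs, abs_mul, abs_of_nonneg (G_nonneg hβ x)]

/-- In particular `G_β` is summable below `β_c`. -/
theorem summable_G {β : ℝ} (hβ : 0 ≤ β) (hβc : β < criticalBeta 3) :
    Summable fun x : Site 3 => twoPointFree 3 β x := by
  have h := summable_weight_mul_G' hβ hβc (w := fun _ => (1 : ℝ)) (A := 0) (B := 1) (q := 0)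
    (fun x => by simp)
  simpa using h

/-- `χ(β) ≥ 1` for `0 ≤ β < β_c` (the term `x = 0` is `1`, the others are `≥ 0`). -/
theorem one_le_tsum_G {β : ℝ} (hβ : 0 ≤ β) (hβc : β < criticalBeta 3) :
    1 ≤ ∑' x : Site 3, twoPointFree 3 β x := by
  rw [← G_zero β]
  exact (summable_G hβ hβc).le_tsum 0 fun x _ => G_nonneg hβ x

/-! ## Continuity in `β` on `(0, β_c)` -/

/-- **Continuity of `β ↦ G_β(x)` on `(0, β_c)`.** -/
theorem continuousAt_G {β₀ : ℝ} (h0 : 0 < β₀) (hc : β₀ < criticalBeta 3) (x : Site 3) :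
    ContinuousAt (fun β => twoPointFree 3 β x) β₀ := by
  rw [continuousAt_iff_continuous_left'_right']
  constructor
  · -- left continuity of the free state (GKS)
    have h := freePair_leftContinuous_of_gks (d := 3)
      (fun _ _ _ _ _ _ => GKSInequalities.gks_two_holds (zdGraph 3))
      isingCorr_free_mono_volume_holds hasBoxLimit_isingCorr_free_holds h0 0 x
    simp only [freePair_zero_left] at h
    exact h
  · -- right continuity: `free = plus` on `[β₀, β_c)` and the plus state is right-continuous
    by_cases hx : x = 0
    · subst hx
      simp only [G_zero]
      exact continuousWithinAt_const
    have hplus := plusCorr_rightContinuous_holds (d := 3) ({0, x} : Finset (Site 3)) h0.le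
    rw [← continuousWithinAt_Ioi_iff_Ici] at hplus
    have heq : ∀ β, 0 ≤ β → β < criticalBeta 3 →
        twoPointFree 3 β x = plusCorr 3 β 0 ({0, x} : Finset (Site 3)) := by
      intro β hβ hβc
      rw [twoPointFree_eq_twoPointPlus_of_spontaneousMagnetization_eq_zero hβ
        (spontaneousMagnetization_eq_zero_of_lt_criticalBeta_holds hβ hβc) x]
      simp [twoPointPlus, plusCorr, spinPair_eq_spinProduct (Ne.symm hx)]
    refine (hplus.congr_of_eventuallyEq ?_ (heq β₀ h0.le hc)).congr_of_eventuallyEq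
      (Eventually.of_forall fun _ => rfl) rfl
    have hmem : Ioo β₀ (criticalBeta 3) ∈ 𝓝[>] β₀ := Ioo_mem_nhdsGT hc
    filter_upwards [hmem] with β hβ
    exact heq β (h0.le.trans hβ.1.le) hβ.2

/-- **Continuity of weighted sums `β ↦ ∑ₓ w(x) G_β(x)` on `(0, β_c)`** for polynomially bounded
weights (dominated convergence: `|w| G_β ≤ |w| G_b` for `β ≤ b < β_c`). -/
theorem continuousAt_tsum_weight_mul_G {w : Site 3 → ℝ} {A B : ℝ} {q : ℕ}
    (hw : ∀ x, |w x| ≤ A * ‖x‖ ^ q + B) {β₀ : ℝ} (h0 : 0 < β₀) (hc : β₀ < criticalBeta 3) :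
    ContinuousAt (fun β => ∑' x : Site 3, w x * twoPointFree 3 β x) β₀ := by
  set a : ℝ := β₀ / 2 with ha
  set b : ℝ := (β₀ + criticalBeta 3) / 2 with hb
  have ha0 : 0 < a := by positivity
  have hab : a < b := by rw [ha, hb]; linarith
  have hbc : b < criticalBeta 3 := by rw [hb]; linarith
  have hS : Icc a b ∈ 𝓝 β₀ := Icc_mem_nhds (by rw [ha]; linarith) (by rw [hb]; linarith)
  refine ContinuousOn.continuousAt ?_ hS
  refine continuousOn_tsum (u := fun x => |w x| * twoPointFree 3 b x) (fun x => ?_)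
    (summable_weight_mul_G (ha0.le.trans hab.le) hbc hw) (fun x β hβ => ?_)
  · intro β hβ
    exact ((continuousAt_G (lt_of_lt_of_le ha0 hβ.1) (lt_of_le_of_lt hβ.2 hbc) x).const_mul
      (w x)).continuousWithinAt
  · have hβ0 : 0 ≤ β := ha0.le.trans hβ.1
    rw [Real.norm_eq_abs, abs_mul, abs_of_nonneg (G_nonneg hβ0 x)]
    exact mul_le_mul_of_nonneg_left (G_mono hβ0 hβ.2 x) (abs_nonneg _)

/-! ## Divergence of the susceptibility -/

/-- Below `β_c` the `ℝ≥0∞`-valued susceptibility is the real series `∑ₓ G_β(x)`. -/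
theorem susceptibility_eq_ofReal_tsum {β : ℝ} (hβ : 0 ≤ β) (hβc : β < criticalBeta 3) :
    susceptibility 3 β = ENNReal.ofReal (∑' x : Site 3, twoPointFree 3 β x) := by
  rw [susceptibility, ENNReal.ofReal_tsum_of_nonneg (G_nonneg hβ) (summable_G hβ hβc)]

/-- **`χ(β) = ∑ₓ G_β(x) → ∞` as `β ↑ β_c`.** -/
theorem tendsto_tsum_G_atTop :
    Tendsto (fun β => ∑' x : Site 3, twoPointFree 3 β x) (𝓝[<] (criticalBeta 3)) atTop := by
  have h := tendsto_susceptibility_nhdsLT_criticalBeta (d := 3) (by norm_num)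
  rw [tendsto_atTop]
  intro M
  have h1 : ∀ᶠ β in 𝓝[<] (criticalBeta 3), ENNReal.ofReal (|M| + 1) < susceptibility 3 β :=
    (tendsto_order.1 h).1 _ ENNReal.ofReal_lt_top
  have h2 : ∀ᶠ β in 𝓝[<] (criticalBeta 3), 0 < β := by
    have : Ioo 0 (criticalBeta 3) ∈ 𝓝[<] (criticalBeta 3) := Ioo_mem_nhdsLT criticalBeta_three_pos
    filter_upwards [this] with β hβ using hβ.1
  have h3 : ∀ᶠ β in 𝓝[<] (criticalBeta 3), β < criticalBeta 3 := eventually_mem_nhdsWithin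
  filter_upwards [h1, h2, h3] with β hβ1 hβ2 hβ3
  rw [susceptibility_eq_ofReal_tsum hβ2.le hβ3, ENNReal.ofReal_lt_ofReal_iff_of_nonneg
    (by positivity)] at hβ1
  linarith [le_abs_self M]

end Summit.CriticalPhenomena.Ising3DConformalLimit.Theorems.HarmonicMomentsIsotropy.Ising

end
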